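import Mathlib
import Summits.ValiantsHypothesis.ValiantsHypothesis.Theorems.SymPencilSymmetrizePermPairsInducedBlockPencil

/-!
# `SymPencil.SymmetrizePermPairs` (stmt-ValiantsHypothesis-17793), stub `stub_induce` — (I1′) the induced block FAMILY of a
# PERMIFIED pencil: permutation-congruence covariance (the exact input of (C3a)/[Q3])

Desk RULING #200 (order update; p7 g11's request under [Q1] p604603).  Companion of
`Theorems/SymPencilSymmetrizePermPairsInducedBlockPencil.lean` ((I1), p604465).

SETTING.  `Γ = Γ_n` (closure of the permutation matrices `P_{π × ρ}`, the Birth skeleton's `permPairSubst n` written out),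
`Γ' ≤ GL(n², ℂ)` with `[Γ : Γ ∩ Γ'] = R < ∞`, and a PERMIFIED affine pencil `A` of `per_n` of size `m`: every `γ ∈ Γ'` lifts as a
permutation CONGRUENCE `A(γ·x) = P_σ · A · P_σᵀ` (the output currency of p6 g12's [A4] `permify` files).  Left cosets
`Q = Γ ⧸ (Γ' ⊓ Γ)`, representatives `rep q := q.out ∈ Γ`, numbered by `Fin R`.

RESULT `inducedBlock_permPairs_perm` (no `sorry`, no `def`): the family of translates `B_i := A(rep q_i · x)`, `i < R`, satisfies
* every `B_i` is an affine determinantal representation of `per_n` (`per_n` is `Γ_n`-invariant: `perPoly_linSubst_permPair`);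
* **covariance in RENAME / PERMUTATION-CONGRUENCE currency** — for every pair `(π, ρ)` there are a permutation `τ` of the
  block labels and permutations `P_i ∈ 𝔖_m` with `B_i(x_{π a, ρ b}) = P_{P_i} · B_{τ i} · P_{P_i}ᵀ` for all `i` (the SAME
  permutation matrix on both sides): `x_{π a, ρ b}`-renaming is the substitution by `γ = P_{π⁻¹ × ρ⁻¹} ∈ Γ_n`
  (`linSubst_permMatrix`), `γ · rep q = rep (γ • q) · h_q` with `h_q ∈ Γ'` (`QuotientGroup.eq`), and `h_q` lifts as a permutation
  congruence which commutes past the outer substitution (`Matrix.linSubstEntries_mul / _map_C / _linSubstEntries`);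
* every `B_i` is a `Γ_n`-translate of `A`, and symmetric when `A` is.
This is VERBATIM the hypothesis block of the (C3) target in p7 g11's memo `HOME/lmr/NOTE-p7g11-17793-C3-equivariantGKKP-sizing.md` §1.

Helper mode (`--supports stmt-ValiantsHypothesis-17793 --as helper`).  Honest framing: bookkeeping for an OPEN stub; the crux
`SymmetrizePermPairs`, `SdcThesis` and VP ≠ VNP are OPEN and NOT moved by this file.
-/

open Matrix MvPolynomial
open Literature.Computability.AlgebraicComplexity

-- the mandated summit-side namespace repeats a component by design (single-problem summit)
set_option linter.dupNamespace false

namespace Summit.ValiantsHypothesis.ValiantsHypothesis.Theorems.SymPencilSymmetrizePermPairs.InducedBlock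

noncomputable section

/-- The permutation matrix of `e⁻¹` is a two-sided inverse of that of `e` (as matrices over `ℂ`). [folklore] -/
theorem permMatrix_mul_permMatrix_symm {ι : Type*} [Fintype ι] [DecidableEq ι] (e : Equiv.Perm ι) :
    e.permMatrix ℂ * e⁻¹.permMatrix ℂ = 1 ∧ e⁻¹.permMatrix ℂ * e.permMatrix ℂ = 1 := by
  constructor
  · rw [← Matrix.permMatrix_mul, inv_mul_cancel, Matrix.permMatrix_one]
  · rw [← Matrix.permMatrix_mul, mul_inv_cancel, Matrix.permMatrix_one]

/-- Renaming `x_{ij} ↦ x_{π i, ρ j}` of the entries is the substitution by the unit `P_{π⁻¹ × ρ⁻¹} ∈ Γ_n`. [folklore] -/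
theorem exists_unit_rename_eq_linSubstEntries {n : ℕ} {ι : Type*} (π ρ : Equiv.Perm (Fin n)) :
    ∃ γ : GL (Fin n × Fin n) ℂ,
      (γ : Matrix (Fin n × Fin n) (Fin n × Fin n) ℂ) = Equiv.Perm.permMatrix ℂ (Equiv.prodCongr π⁻¹ ρ⁻¹) ∧
      ∀ A : Matrix ι ι (MvPolynomial (Fin n × Fin n) ℂ),
        A.map (MvPolynomial.rename fun ij : Fin n × Fin n => (π ij.1, ρ ij.2)) = Matrix.linSubstEntries γ A := by
  obtain ⟨h1, h2⟩ := permMatrix_mul_permMatrix_symm (Equiv.prodCongr π⁻¹ ρ⁻¹ : Equiv.Perm (Fin n × Fin n))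
  refine ⟨⟨_, _, h1, h2⟩, rfl, fun A => Matrix.ext fun i j => ?_⟩
  simp only [Matrix.linSubstEntries, Matrix.map_apply]
  show _ = linSubst (Fin n × Fin n) ℂ (Equiv.Perm.permMatrix ℂ (Equiv.prodCongr π⁻¹ ρ⁻¹)) (A i j)
  rw [linSubst_permMatrix, Equiv.prodCongr_symm, Equiv.prodCongr_apply]
  rfl

/-- **(I1′) The induced block family of a permified pencil — permutation-congruence covariance.**  See the module
docstring; the covariance clause is verbatim the hypothesis of the (C3) target of p7 g11's memo §1.
[cite: LandsbergRessayre2017, Def. 1.3] -/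
theorem inducedBlock_permPairs_perm (n m : ℕ) (Γ Γ' : Subgroup (GL (Fin n × Fin n) ℂ))
    (hΓ : Γ = Subgroup.closure {γ : GL (Fin n × Fin n) ℂ | ∃ π ρ : Equiv.Perm (Fin n),
        (γ : Matrix (Fin n × Fin n) (Fin n × Fin n) ℂ) = Equiv.Perm.permMatrix ℂ (Equiv.prodCongr π ρ)})
    [(Γ'.subgroupOf Γ).FiniteIndex]
    (A : Matrix (Fin m) (Fin m) (MvPolynomial (Fin n × Fin n) ℂ)) (hA : IsAffineDetRepr (perPoly (Fin n) ℂ) A)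
    (hperm : ∀ γ ∈ Γ', ∃ σ : Equiv.Perm (Fin m),
      Matrix.linSubstEntries γ A = (σ.permMatrix ℂ).map C * A * ((σ.permMatrix ℂ)ᵀ).map C) :
    ∃ B : Fin (Γ'.relIndex Γ) → Matrix (Fin m) (Fin m) (MvPolynomial (Fin n × Fin n) ℂ),
      (∀ i, IsAffineDetRepr (perPoly (Fin n) ℂ) (B i)) ∧
      (∀ π ρ : Equiv.Perm (Fin n), ∃ (τ : Equiv.Perm (Fin (Γ'.relIndex Γ)))
          (P : Fin (Γ'.relIndex Γ) → Equiv.Perm (Fin m)), ∀ i,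
        (B i).map (MvPolynomial.rename fun ij : Fin n × Fin n => (π ij.1, ρ ij.2)) =
          ((P i).permMatrix ℂ).map C * B (τ i) * (((P i).permMatrix ℂ)ᵀ).map C) ∧
      (∀ i, ∃ g ∈ Γ, B i = Matrix.linSubstEntries g A) ∧
      (A.IsSymm → ∀ i, (B i).IsSymm) := by
  classical
  -- cosets and their numbering
  set H : Subgroup Γ := Γ'.subgroupOf Γ with hH
  let Q := Γ ⧸ H
  haveI : Fintype Q := Fintype.ofFinite Q
  let eQ : Q ≃ Fin (Γ'.relIndex Γ) := Finite.equivFin Q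
  let rep : Q → GL (Fin n × Fin n) ℂ := fun q => ((Quotient.out q : Γ) : GL (Fin n × Fin n) ℂ)
  let B : Fin (Γ'.relIndex Γ) → Matrix (Fin m) (Fin m) (MvPolynomial (Fin n × Fin n) ℂ) :=
    fun i => Matrix.linSubstEntries (rep (eQ.symm i)) A
  have hinv := perPoly_linSubst_permPair n
  rw [← hΓ] at hinv
  refine ⟨B, fun i => ⟨fun a b => totalDegree_linSubstEntries_le _ hA.1 _ _, ?_⟩, ?_, fun i =>
    ⟨rep (eQ.symm i), (Quotient.out (eQ.symm i) : Γ).2, rfl⟩, fun hs i => ?_⟩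
  · -- determinant of a translate
    show (Matrix.linSubstEntries (rep (eQ.symm i)) A).det = perPoly (Fin n) ℂ
    rw [Matrix.linSubstEntries, ← AlgHom.mapMatrix_apply, ← AlgHom.map_det, hA.2]
    exact hinv _ (Quotient.out (eQ.symm i) : Γ).2
  · -- covariance
    intro π ρ
    obtain ⟨γ, hγval, hγA⟩ := exists_unit_rename_eq_linSubstEntries (ι := Fin m) π ρ
    have hγ : γ ∈ Γ := by
      rw [hΓ]; exact Subgroup.subset_closure ⟨π⁻¹, ρ⁻¹, hγval⟩
    let γΓ : Γ := ⟨γ, hγ⟩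
    let τQ : Equiv.Perm Q := MulAction.toPerm γΓ
    -- `γ · rep q = rep (γ • q) · h₀ q` with `h₀ q ∈ Γ'`
    let h₀ : Q → Γ := fun q => (Quotient.out (τQ q))⁻¹ * (γΓ * Quotient.out q)
    have hh₀ : ∀ q, (h₀ q : GL (Fin n × Fin n) ℂ) ∈ Γ' := by
      intro q
      have hq : ((Quotient.out (τQ q) : Γ) : Q) = ((γΓ * Quotient.out q : Γ) : Q) := by
        rw [QuotientGroup.out_eq', ← smul_eq_mul, ← MulAction.Quotient.smul_coe, QuotientGroup.out_eq']
        rfl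
      exact Subgroup.mem_subgroupOf.mp (QuotientGroup.eq.mp hq)
    have hfac : ∀ q, γ * rep q = rep (τQ q) * (h₀ q : GL (Fin n × Fin n) ℂ) := by
      intro q
      show γ * ((Quotient.out q : Γ) : GL (Fin n × Fin n) ℂ) =
        ((Quotient.out (τQ q) : Γ) : GL (Fin n × Fin n) ℂ) *
          (((Quotient.out (τQ q))⁻¹ * (γΓ * Quotient.out q) : Γ) : GL (Fin n × Fin n) ℂ)
      rw [Subgroup.coe_mul, Subgroup.coe_mul, Subgroup.coe_inv, mul_inv_cancel_left]
    choose σ hσ using fun q => hperm _ (hh₀ q)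
    refine ⟨(eQ.symm.trans τQ).trans eQ, fun i => σ (eQ.symm i), fun i => ?_⟩
    show (Matrix.linSubstEntries (rep (eQ.symm i)) A).map _ =
      ((σ (eQ.symm i)).permMatrix ℂ).map C * Matrix.linSubstEntries (rep (eQ.symm (eQ (τQ (eQ.symm i))))) A *
        (((σ (eQ.symm i)).permMatrix ℂ)ᵀ).map C
    rw [hγA, Equiv.symm_apply_apply, Matrix.linSubstEntries_linSubstEntries, hfac,
      ← Matrix.linSubstEntries_linSubstEntries, hσ, Matrix.linSubstEntries_mul, Matrix.linSubstEntries_mul,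
      Matrix.linSubstEntries_map_C, Matrix.linSubstEntries_map_C]
  · -- symmetry
    show (Matrix.linSubstEntries (rep (eQ.symm i)) A)ᵀ = Matrix.linSubstEntries (rep (eQ.symm i)) A
    rw [← Matrix.linSubstEntries_transpose, hs.eq]

end

end Summit.ValiantsHypothesis.ValiantsHypothesis.Theorems.SymPencilSymmetrizePermPairs.InducedBlock
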